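import Summits.RiemannHypothesis.RiemannHypothesis.Theses.RobinHighStaircase
import Summits.RiemannHypothesis.RiemannHypothesis.Theorems.Splittings.RobinFiniteHighCoverRanges
import HarnessLib

/-!
# Route RobinHighStaircase (L21 / (ix-o) «ROBIN · HIGH STAIRCASE») — `RowsH18to21` (item stmt-RiemannHypothesis-22029) closed BY NAME

The rows H18–H21 «two θ-prints + RH verified to `T ≥ 2.22·10⁶ / 4.48·10⁶ / 9.07·10⁶ / 1.87·10⁷` ⟹ Robin at every CA
`N > 5040` with all primes `< 4^19 / 4^20 / 4^21 / 4^22`».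
The row is, conjunct by conjunct, the lane (ix-o) tree theorems
`Summit.RiemannHypothesis.RiemannHypothesis.Theorems.Splittings.RobinFiniteC1.robinCA_below_high_<T>` for
T = 2220000, 4480000, 9070000, 18700000 (Theorems/Splittings/RobinFiniteHighCoverRanges.lean, typer-1 g6's H6). One-term closer.
CONDITIONAL bookkeeping on the two printed θ-facts (Büthe 2018 Thm 2, BKLNW 2021) and `RiemannHypothesisUpTo T`
(hypotheses, not discharged); RH is not proved by this; nothing here bears on the truth of RH.
-/

-- D-0017: `Summit.RiemannHypothesis.RiemannHypothesis.…` duplicates the namespace BY DESIGN (single-problem summit).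
set_option linter.dupNamespace false

namespace Summit.RiemannHypothesis.RiemannHypothesis.Theorems.RobinHighStaircase

/-- **`RowsH18to21` (item stmt-RiemannHypothesis-22029)** holds: the lane (ix-o) tree theorems
`Splittings.RobinFiniteC1.robinCA_below_high_<T>` (T = 2220000, 4480000, 9070000, 18700000), by name. -/
theorem rowsH18to21_proof :
    Summit.RiemannHypothesis.RiemannHypothesis.Theses.RobinHighStaircase.RowsH18to21 :=
  fun hB hK ↦
    ⟨fun _T hT hRH ↦ Splittings.RobinFiniteC1.robinCA_below_high_2220000 hB hK hT hRH,
      fun _T hT hRH ↦ Splittings.RobinFiniteC1.robinCA_below_high_4480000 hB hK hT hRH,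
      fun _T hT hRH ↦ Splittings.RobinFiniteC1.robinCA_below_high_9070000 hB hK hT hRH,
      fun _T hT hRH ↦ Splittings.RobinFiniteC1.robinCA_below_high_18700000 hB hK hT hRH⟩

end Summit.RiemannHypothesis.RiemannHypothesis.Theorems.RobinHighStaircase
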